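import Literature.Topology.FourManifolds.LefschetzBaseCircleMaps
import Literature.Topology.FourManifolds.LefschetzBaseOpenBook
import HarnessLib

/-!
# Two symmetries of the Lefschetz base: the sheet involution and the sector rotation

Topic `Literature/Topology/FourManifolds`; the base `Base g = {ρ ≤ 1/4} ⊂ ℂ²` of the genus-`g`
Lefschetz fibration model (`LefschetzBaseModel.lean`, `ρ = ‖y² − x^{2g+1} − 1‖² + η(‖x‖²)`) has
the symmetries

* `iota : (x, y) ↦ (x, −y)` — **the sheet involution** (the deck transformation of the double
  cover `y² = x^{2g+1} + 1 + w`), and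
* `rot : (x, y) ↦ (μ x, y)`, `μ = e^{2πi/(2g+1)}` — **the sector rotation**,

both preserving `ρ`, `w` and `Re x^{2g+1}`, hence the Milnor cover `U`, `V` of
`LefschetzBaseCover.lean`.  On the overlap `U ∩ V ≃ Fin 2 × Fin (2g+1)` (`idxW`,
`LefschetzBaseCoverOverlap.lean`) they act by `(j, k) ↦ (j + 1, k)` (`idxW_iota`) and
`(j, k) ↦ (j, k + 1)` (`idxW_rot`): together they permute the `2(2g+1)` components of `U ∩ V`
transitively.  This is the symmetry input of the proof that the Mayer–Vietoris circle maps
`phi g j` lift near the binding of the base open book (`LefschetzBaseBindingLift.lean`), the last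
base-side input of the Legendrian-realisation step of
`Literature.Geometry.Symplectic.palf_stein_supportedByBoundaryOpenBook`.  Milnor 1968, §9
(the `μ_p × μ_q`-symmetry of the Pham–Brieskorn fibre); everything is proved, no named facts.

## References
* J. Milnor, *Singular points of complex hypersurfaces* (1968), §9, Lemma 9.2 and the join
  description of the fibre. [Milnor1968]
* R. Bott, L. W. Tu, *Differential Forms in Algebraic Topology* (1982), §2. [BottTu1982Forms]
-/

noncomputable section

open scoped Manifold ContDiff Topology
open Set Function
open Literature.Topology.FourManifolds.TorusKnotMilnor

namespace Literature.Topology.FourManifolds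

/-- Local notation: `𝔼 n` is the model Euclidean space `EuclideanSpace ℝ (Fin n)`. -/
local notation "𝔼 " n:arg => EuclideanSpace ℝ (Fin n)

namespace LefschetzBase

variable {g : ℕ}

/-! ### The sheet involution `(x, y) ↦ (x, −y)` -/

/-- The sheet involution on `ℂ²`. [cite: Milnor1968, §9] -/
def iotaFun (p : 𝔼 4) : 𝔼 4 := mk (cx p) (-cy p)

/-- `x` of the sheet involution. [folklore] -/
@[simp] theorem cx_iotaFun (p : 𝔼 4) : cx (iotaFun p) = cx p := cx_mk _ _

/-- `y` of the sheet involution. [folklore] -/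
@[simp] theorem cy_iotaFun (p : 𝔼 4) : cy (iotaFun p) = -cy p := cy_mk _ _

/-- `w` is invariant under the sheet involution. [folklore] -/
theorem w_iotaFun (g : ℕ) (p : 𝔼 4) : w g (iotaFun p) = w g p := by
  simp only [w, Phi, cx_iotaFun, cy_iotaFun, neg_sq]

/-- `ρ` is invariant under the sheet involution. [folklore] -/
theorem rho_iotaFun (g : ℕ) (p : 𝔼 4) : rho g (iotaFun p) = rho g p := by
  simp only [rho, w_iotaFun, cx_iotaFun]

/-- The sheet involution is an involution. [folklore] -/
theorem iotaFun_iotaFun (p : 𝔼 4) : iotaFun (iotaFun p) = p := by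
  rw [iotaFun, cx_iotaFun, cy_iotaFun, neg_neg, mk_cx_cy]

/-- The sheet involution is smooth. [folklore] -/
theorem contDiff_iotaFun : ContDiff ℝ ∞ iotaFun :=
  contDiff_iff_contDiffAt.2 fun _ => contDiffAt_mk contDiff_cx.contDiffAt contDiff_cy.neg.contDiffAt

/-- **The sheet involution of the base** `iota : Base g → Base g`. [cite: Milnor1968, §9] -/
def iota (g : ℕ) : C(Base g, Base g) :=
  ⟨fun p => ⟨iotaFun p.1, by
      have hp : rho g p.1 ≤ 1 / 4 := p.2
      show rho g (iotaFun p.1) ≤ 1 / 4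
      rwa [rho_iotaFun]⟩,
    (contDiff_iotaFun.continuous.comp continuous_subtype_val).subtype_mk _⟩

/-- The sheet involution read in `ℂ²`. [folklore] -/
@[simp] theorem iota_apply_coe (p : Base g) : (iota g p).1 = iotaFun p.1 := rfl

/-- `Re x^{2g+1}` is invariant under the sheet involution. [folklore] -/
theorem rePow_iota (p : Base g) : rePow (iota g p) = rePow p := by
  rw [rePow, rePow, iota_apply_coe, cx_iotaFun]

/-- `iota ∘ iota = id`. [folklore] -/
theorem iota_iota (p : Base g) : iota g (iota g p) = p :=
  Subtype.ext (by rw [iota_apply_coe, iota_apply_coe, iotaFun_iotaFun])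

/-! ### The sector rotation `(x, y) ↦ (μ x, y)` -/

/-- The sector rotation on `ℂ²`, `μ = e^{2πi/(2g+1)}`. [cite: Milnor1968, §9] -/
def rotFun (g : ℕ) (p : 𝔼 4) : 𝔼 4 := mk (rootU (2 * g + 1) * cx p) (cy p)

/-- `x` of the sector rotation. [folklore] -/
@[simp] theorem cx_rotFun (g : ℕ) (p : 𝔼 4) : cx (rotFun g p) = rootU (2 * g + 1) * cx p := cx_mk _ _

/-- `y` of the sector rotation. [folklore] -/
@[simp] theorem cy_rotFun (g : ℕ) (p : 𝔼 4) : cy (rotFun g p) = cy p := cy_mk _ _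

/-- `(μ x)^{2g+1} = x^{2g+1}`. [folklore] -/
theorem rootU_mul_pow (g : ℕ) (x : ℂ) : (rootU (2 * g + 1) * x) ^ (2 * g + 1) = x ^ (2 * g + 1) := by
  rw [mul_pow, rootU_pow_self (odd_ne_zero g), one_mul]

/-- `w` is invariant under the sector rotation. [folklore] -/
theorem w_rotFun (g : ℕ) (p : 𝔼 4) : w g (rotFun g p) = w g p := by
  simp only [w, Phi, cx_rotFun, cy_rotFun, rootU_mul_pow]

/-- `‖μ x‖ = ‖x‖`. [folklore] -/
theorem norm_rootU_mul (n : ℕ) (x : ℂ) : ‖rootU n * x‖ = ‖x‖ := by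
  rw [norm_mul, norm_rootU, one_mul]

/-- `ρ` is invariant under the sector rotation. [folklore] -/
theorem rho_rotFun (g : ℕ) (p : 𝔼 4) : rho g (rotFun g p) = rho g p := by
  simp only [rho, w_rotFun, cx_rotFun, norm_rootU_mul]

/-- The sector rotation is smooth. [folklore] -/
theorem contDiff_rotFun (g : ℕ) : ContDiff ℝ ∞ (rotFun g) :=
  contDiff_iff_contDiffAt.2 fun _ =>
    contDiffAt_mk (contDiff_const.mul contDiff_cx).contDiffAt contDiff_cy.contDiffAt

/-- **The sector rotation of the base** `rot : Base g → Base g`. [cite: Milnor1968, §9] -/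
def rot (g : ℕ) : C(Base g, Base g) :=
  ⟨fun p => ⟨rotFun g p.1, by
      have hp : rho g p.1 ≤ 1 / 4 := p.2
      show rho g (rotFun g p.1) ≤ 1 / 4
      rwa [rho_rotFun]⟩,
    ((contDiff_rotFun g).continuous.comp continuous_subtype_val).subtype_mk _⟩

/-- The sector rotation read in `ℂ²`. [folklore] -/
@[simp] theorem rot_apply_coe (p : Base g) : (rot g p).1 = rotFun g p.1 := rfl

/-- `Re x^{2g+1}` is invariant under the sector rotation. [folklore] -/
theorem rePow_rot (p : Base g) : rePow (rot g p) = rePow p := by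
  rw [rePow, rePow, rot_apply_coe, cx_rotFun, rootU_mul_pow]

/-! ### The action on the components of `U ∩ V` -/

/-- The sheet involution preserves `U ∩ V`. [folklore] -/
theorem iota_mem_inter (q : ↥(coverU g ∩ coverV g)) : iota g q.1 ∈ coverU g ∩ coverV g := by
  have h := q.2
  rw [mem_inter_iff, mem_coverU_iff, mem_coverV_iff] at h ⊢
  rwa [rePow_iota]

/-- The sector rotation preserves `U ∩ V`. [folklore] -/
theorem rot_mem_inter (q : ↥(coverU g ∩ coverV g)) : rot g q.1 ∈ coverU g ∩ coverV g := by
  have h := q.2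
  rw [mem_inter_iff, mem_coverU_iff, mem_coverV_iff] at h ⊢
  rwa [rePow_rot]

/-- On `U`, `y² ≠ 0` (`Re y² = Re x^{2g+1} + 1 + Re w > −3/8 + 1 − 1/2 > 0`). [folklore] -/
theorem cy_sq_ne_zero_of_mem_coverU {p : Base g} (hp : p ∈ coverU g) : cy p.1 ^ 2 ≠ 0 := by
  have h1 : -(3 / 8 : ℝ) < (cx p.1 ^ (2 * g + 1)).re := hp
  have h2 : |(w g p.1).re| ≤ 1 / 2 := (Complex.abs_re_le_norm _).trans (norm_w_le p)
  have h3 : cy p.1 ^ 2 = cx p.1 ^ (2 * g + 1) + 1 + w g p.1 := by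
    show cy p.1 ^ 2 = cx p.1 ^ (2 * g + 1) + 1 + (cy p.1 ^ 2 - cx p.1 ^ (2 * g + 1) - 1); ring
  intro h
  have h4 := congrArg Complex.re h3
  rw [h, Complex.zero_re, Complex.add_re, Complex.add_re, Complex.one_re] at h4
  linarith [neg_abs_le (w g p.1).re]

/-- On `V`, `x^{2g+1} ≠ 0`. [folklore] -/
theorem xPow_ne_zero_of_mem_coverV {p : Base g} (hp : p ∈ coverV g) : cx p.1 ^ (2 * g + 1) ≠ 0 := by
  intro h
  have h1 : (cx p.1 ^ (2 * g + 1)).re < -(1 / 4 : ℝ) := hp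
  rw [h, Complex.zero_re] at h1
  linarith

/-- The sector denominator `ν (−x^{2g+1})^{1/(2g+1)}` has `(2g+1)`-st power `x^{2g+1}`. [folklore] -/
theorem denV_pow_eq (g : ℕ) (x : ℂ) :
    (halfRoot (2 * g + 1) * prRoot (2 * g + 1) (-x ^ (2 * g + 1))) ^ (2 * g + 1) = x ^ (2 * g + 1) := by
  rw [mul_pow, halfRoot_pow (odd_ne_zero g), prRoot_pow (odd_ne_zero g)]; ring

/-- The sheet sign `y/√(y²)` squares to `1` on `U`. [folklore] -/
theorem sheetSign_sq {p : Base g} (hp : p ∈ coverU g) : (cy p.1 / csqrt (cy p.1 ^ 2)) ^ 2 = 1 := by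
  rw [div_pow, csqrt_sq, div_self (cy_sq_ne_zero_of_mem_coverU hp)]

/-- The sector root `x/(ν (−x^{2g+1})^{1/(2g+1)})` is a `(2g+1)`-st root of unity on `V`. [folklore] -/
theorem sectorRoot_pow {p : Base g} (hp : p ∈ coverV g) :
    (cx p.1 / (halfRoot (2 * g + 1) * prRoot (2 * g + 1) (-cx p.1 ^ (2 * g + 1)))) ^ (2 * g + 1) = 1 := by
  rw [div_pow, denV_pow_eq, div_self (xPow_ne_zero_of_mem_coverV hp)]

/-- `rootIdx (−ζ) = rootIdx ζ + 1` in `Fin 2` for `ζ = ±1`. [folklore] -/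
theorem rootIdx_two_neg {a : ℂ} (ha : a ^ 2 = 1) :
    rootIdx two_ne_zero (-a) = rootIdx two_ne_zero a + 1 := by
  have hk := rootU_pow_rootIdx two_ne_zero ha
  generalize rootIdx two_ne_zero a = K at hk ⊢
  have hμ : rootU 2 = -1 := by have := rootU_two_pow_one; simpa using this
  fin_cases K
  · have ha1 : a = 1 := by rw [← hk]; simp
    rw [ha1]
    show rootIdx two_ne_zero (-1) = 0 + 1
    rw [zero_add, ← rootU_two_pow_one, rootIdx_rootU_pow]
  · have ha1 : a = -1 := by rw [← hk]; simp [hμ]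
    rw [ha1, neg_neg]
    show rootIdx two_ne_zero 1 = 1 + 1
    have h11 : (1 : Fin 2) + 1 = 0 := by decide
    rw [h11, ← rootU_two_pow_zero, rootIdx_rootU_pow]

/-- `rootIdx (μ ζ) = rootIdx ζ + 1` in `Fin n` for an `n`-th root of unity `ζ`. [folklore] -/
theorem rootIdx_rootU_mul {n : ℕ} [NeZero n] {b : ℂ} (hb : b ^ n = 1) :
    rootIdx (NeZero.ne n) (rootU n * b) = rootIdx (NeZero.ne n) b + 1 := by
  have hn : n ≠ 0 := NeZero.ne n
  have hk := rootU_pow_rootIdx hn hb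
  generalize rootIdx hn b = K at hk ⊢
  have e1 : rootU n * b = rootU n ^ ((K : ℕ) + 1) := by rw [← hk, pow_succ, mul_comm]
  by_cases hlt : (K : ℕ) + 1 < n
  · have hval : (((K + 1 : Fin n)) : ℕ) = (K : ℕ) + 1 := by
      rw [Fin.val_add, Fin.val_one', Nat.add_mod_mod, Nat.mod_eq_of_lt hlt]
    rw [e1, ← hval, rootIdx_rootU_pow]
  · have heq : (K : ℕ) + 1 = n := by have := K.2; omega
    have hval : (((K + 1 : Fin n)) : ℕ) = 0 := by
      rw [Fin.val_add, Fin.val_one', Nat.add_mod_mod, heq, Nat.mod_self]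
    have e2 : rootU n * b = rootU n ^ (((K + 1 : Fin n)) : ℕ) := by
      rw [e1, heq, rootU_pow_self hn, hval, pow_zero]
    rw [e2, rootIdx_rootU_pow]

/-- **The sheet involution swaps the sheets and fixes the sectors**:
`idxW (ι q) = ((idxW q).1 + 1, (idxW q).2)`. [cite: Milnor1968, §9] -/
theorem idxW_iota (q : ↥(coverU g ∩ coverV g)) :
    idxW ⟨iota g q.1, iota_mem_inter q⟩ = ((idxW q).1 + 1, (idxW q).2) := by
  rw [idxW_apply, idxW_apply]
  dsimp only
  rw [iota_apply_coe, cx_iotaFun, cy_iotaFun, neg_sq, neg_div, rootIdx_two_neg (sheetSign_sq q.2.1)]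

/-- **The sector rotation fixes the sheets and shifts the sectors**:
`idxW (R q) = ((idxW q).1, (idxW q).2 + 1)`. [cite: Milnor1968, §9] -/
theorem idxW_rot (q : ↥(coverU g ∩ coverV g)) :
    idxW ⟨rot g q.1, rot_mem_inter q⟩ = ((idxW q).1, (idxW q).2 + 1) := by
  rw [idxW_apply, idxW_apply]
  dsimp only
  rw [rot_apply_coe, cx_rotFun, cy_rotFun, rootU_mul_pow, mul_div_assoc,
    rootIdx_rootU_mul (sectorRoot_pow q.2.2)]

end LefschetzBase

end Literature.Topology.FourManifolds
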